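import Mathlib.Geometry.Manifold.Instances.Sphere
import Mathlib.Analysis.Normed.Module.Connected
import Mathlib.Topology.Connected.PathConnected
import Literature.Topology.FourManifolds.ImmersionCriterion
import Literature.Topology.FourManifolds.BordismProofs
import HarnessLib

/-!
# The slices `S⁴ × {c}` of the round cylinder `S⁴ × ℝ ⊂ ℝ⁶` are smoothly embedded cross-sections

Topic `Literature/Geometry/Manifold` (general infrastructure; written by the standing disprover of the crux
`SliceIsolation` of route `SmoothPoincare4/CylinderEntropy`, refuter-cdisprove-stmt-SmoothPoincare4-7632-0, whose
items it serves).  Those route items quantify over smooth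
embeddings `ι : M → ℝ⁶` (`Manifold.IsSmoothEmbedding (𝓡 4) (𝓡 6) ∞`) with `∑_{i<5} (ι x)ᵢ² = 1` whose image
separates the two ends of the round cylinder `N = {∑_{i<5} zᵢ² = 1}`.  This file provides, sorry-free, the basic
witnesses every non-vacuity / load-bearing argument about these items needs:

* `sliceMap c : S⁴ → ℝ⁶`, `x ↦ (x, c)` — lies in `N` (`sum_sq_sliceMap`), has image the slice
  `{z ∈ N | z₅ = c}` (`range_sliceMap`), and **is a `C^∞` embedding in Mathlib's chart sense**
  (`isSmoothEmbedding_sliceMap`: affine map with injective linear part after the sphere inclusion, whose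
  differential is injective by Mathlib's `mfderiv_coe_sphere_injective`; then the tree's immersion criterion
  `Literature.Topology.FourManifolds.isSmoothEmbedding_of_injective_of_injective_mfderiv`);
* `separatesEnds_of_slice_subset` — **a subset of `ℝ⁶` containing a whole slice separates the ends** in the
  typed sense (no path in `N ∖ A` from height `≤ -R` to height `≥ R`, `R = |c| + 1`; intermediate value theorem
  on the height of the path);
* `twoSlices : S⁴ ⊔ S⁴ → ℝ⁶` (slices at heights `0` and `1`) is again a smooth embedding
  (`isSmoothEmbedding_twoSlices`, by the tree's `Manifold.IsSmoothEmbedding.sumElim`), and `S⁴ ⊔ S⁴` is not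
  diffeomorphic to `S⁴` (`isEmpty_diffeomorph_twoSpheres`: `S⁴` is preconnected, `S⁴ ⊔ S⁴` is not).

Consumers: the non-vacuity of `SliceIsolation` / `CylinderRungTwo` / `ThinCrossSectionExists` for `M = S⁴`
(given the calibration item), the load-bearing analysis of the crux (variants with hypotheses dropped that are
false), and `AreaFloor`-type arguments.  Everything is proved; no facts and no `Prop`-valued definitions are
introduced.  Coordinates are the concrete ones of the route items (`Fin.castSucc i`, `i : Fin 5`, and `5 : Fin 6`).
-/

noncomputable section

open scoped Manifold ContDiff Topology
open Set Function

namespace Literature.Geometry.Manifold.CylinderSlice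

/-! ### The affine map `y ↦ (y, c)` -/

/-- The coordinate functionals of the "pad with a zero last coordinate" map `ℝ⁵ → ℝ⁶`: the five
coordinate projections followed by `0`. [folklore] -/
def padCoords : Fin 6 → (EuclideanSpace ℝ (Fin 5) →L[ℝ] ℝ) :=
  Fin.snoc (fun i : Fin 5 => EuclideanSpace.proj i) 0

/-- `ℝ⁵ → ℝ⁶`, `y ↦ (y, 0)`, as a continuous linear map. [folklore] -/
def padL : EuclideanSpace ℝ (Fin 5) →L[ℝ] EuclideanSpace ℝ (Fin 6) :=
  (EuclideanSpace.equiv (Fin 6) ℝ).symm.toContinuousLinearMap.comp (ContinuousLinearMap.pi padCoords)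

/-- The first five coordinates of `padL y` are those of `y`. [folklore] -/
@[simp] theorem padL_apply_castSucc (y : EuclideanSpace ℝ (Fin 5)) (i : Fin 5) :
    padL y (Fin.castSucc i) = y i := by
  simp [padL, padCoords]

/-- The last coordinate of `padL y` is `0`. [folklore] -/
@[simp] theorem padL_apply_last (y : EuclideanSpace ℝ (Fin 5)) : padL y 5 = 0 := by
  have h : Fin.snoc (α := fun _ : Fin 6 => EuclideanSpace ℝ (Fin 5) →L[ℝ] ℝ)
      (fun i : Fin 5 => EuclideanSpace.proj i) 0 (Fin.last 5) = 0 := Fin.snoc_last _ _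
  simp only [padL, padCoords, ContinuousLinearMap.coe_comp, ContinuousLinearEquiv.coe_coe,
    Function.comp_apply]
  change (ContinuousLinearMap.pi padCoords y) (Fin.last 5) = 0
  rw [ContinuousLinearMap.pi_apply, padCoords, h]
  rfl

/-- `padL` is injective (read off the first five coordinates). [folklore] -/
theorem padL_injective : Injective padL := by
  intro y y' h
  ext i
  simpa using congrArg (fun z : EuclideanSpace ℝ (Fin 6) => z (Fin.castSucc i)) h

/-- The unit vector `e₅` of `ℝ⁶`, the axis direction of the cylinder `S⁴ × ℝ`. [folklore] -/
def axis : EuclideanSpace ℝ (Fin 6) := EuclideanSpace.single 5 1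

/-- An index of the form `Fin.castSucc i`, `i : Fin 5`, is not the last index `5 : Fin 6`. [folklore] -/
theorem castSucc_ne_five (i : Fin 5) : (Fin.castSucc i : Fin 6) ≠ 5 := by
  simp [Fin.ext_iff]; omega

/-! ### The slice embeddings -/

/-- **The slice embedding** `S⁴ → S⁴ × {c} ⊂ ℝ⁶`, `x ↦ (x, c)`. [folklore] -/
def sliceMap (c : ℝ) (x : Metric.sphere (0 : EuclideanSpace ℝ (Fin 5)) 1) : EuclideanSpace ℝ (Fin 6) :=
  padL (x : EuclideanSpace ℝ (Fin 5)) + c • axis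

/-- `sliceMap c` is the affine map `y ↦ padL y + c e₅` after the sphere inclusion. [folklore] -/
theorem sliceMap_eq_comp (c : ℝ) :
    sliceMap c = (fun y : EuclideanSpace ℝ (Fin 5) => padL y + c • axis) ∘ Subtype.val := rfl

/-- The first five coordinates of `sliceMap c x` are those of `x`. [folklore] -/
@[simp] theorem sliceMap_apply_castSucc (c : ℝ) (x : Metric.sphere (0 : EuclideanSpace ℝ (Fin 5)) 1)
    (i : Fin 5) : sliceMap c x (Fin.castSucc i) = (x : EuclideanSpace ℝ (Fin 5)) i := by
  simp [sliceMap, axis, castSucc_ne_five i]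

/-- The height (last coordinate) of `sliceMap c x` is `c`. [folklore] -/
@[simp] theorem sliceMap_apply_last (c : ℝ) (x : Metric.sphere (0 : EuclideanSpace ℝ (Fin 5)) 1) :
    sliceMap c x 5 = c := by
  simp [sliceMap, axis]

/-- Points of the unit sphere of `ℝ⁵` satisfy `∑ᵢ xᵢ² = 1`. [folklore] -/
theorem sum_sq_eq_one (x : Metric.sphere (0 : EuclideanSpace ℝ (Fin 5)) 1) :
    ∑ i : Fin 5, (x : EuclideanSpace ℝ (Fin 5)) i ^ 2 = 1 := by
  have h1 : ‖(x : EuclideanSpace ℝ (Fin 5))‖ = 1 := mem_sphere_zero_iff_norm.mp x.2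
  have h2 := EuclideanSpace.norm_sq_eq (x : EuclideanSpace ℝ (Fin 5))
  rw [h1, one_pow] at h2
  simpa [Real.norm_eq_abs, sq_abs] using h2.symm

/-- The slice embedding lands in the cylinder `N = {∑_{i<5} zᵢ² = 1}` (the typed membership
hypothesis of the route items). [folklore] -/
theorem sum_sq_sliceMap (c : ℝ) (x : Metric.sphere (0 : EuclideanSpace ℝ (Fin 5)) 1) :
    ∑ i : Fin 5, sliceMap c x (Fin.castSucc i) ^ 2 = 1 := by
  simp only [sliceMap_apply_castSucc]
  exact sum_sq_eq_one x

/-- **The image of the slice embedding is the slice** `{z ∈ N | z₅ = c}`. [folklore] -/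
theorem range_sliceMap (c : ℝ) :
    Set.range (sliceMap c) =
      {z : EuclideanSpace ℝ (Fin 6) | ∑ i : Fin 5, z (Fin.castSucc i) ^ 2 = 1 ∧ z 5 = c} := by
  ext z
  constructor
  · rintro ⟨x, rfl⟩
    exact ⟨sum_sq_sliceMap c x, sliceMap_apply_last c x⟩
  · rintro ⟨hz, hz5⟩
    let y : EuclideanSpace ℝ (Fin 5) := WithLp.toLp 2 fun i => z (Fin.castSucc i)
    have hy : ∀ i, y i = z (Fin.castSucc i) := fun i => rfl
    have hnorm : ‖y‖ = 1 := by
      rw [EuclideanSpace.norm_eq, Real.sqrt_eq_one]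
      simpa [hy, Real.norm_eq_abs, sq_abs] using hz
    refine ⟨⟨y, by simpa using hnorm⟩, ?_⟩
    ext j
    induction j using Fin.lastCases with
    | last => rw [show (Fin.last 5 : Fin 6) = 5 from rfl, sliceMap_apply_last, hz5]
    | cast i => rw [sliceMap_apply_castSucc]

/-- **The slice embedding is a `C^∞` embedding** in Mathlib's chart sense
(`Manifold.IsSmoothEmbedding (𝓡 4) (𝓡 6) ∞`): `y ↦ padL y + c e₅` is affine with injective linear part,
the sphere inclusion has injective differential (`mfderiv_coe_sphere_injective`), and an injective map
with injective differential on a compact manifold is a smooth embedding (tree: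
`Literature.Topology.FourManifolds.isSmoothEmbedding_of_injective_of_injective_mfderiv`, Hirsch Ch. 1 §3
Thm. 3.1). [folklore] -/
theorem isSmoothEmbedding_sliceMap (c : ℝ) :
    Manifold.IsSmoothEmbedding (𝓡 4) (𝓡 6) ∞ (sliceMap c) := by
  haveI : Fact (Module.finrank ℝ (EuclideanSpace ℝ (Fin 5)) = 4 + 1) := ⟨finrank_euclideanSpace_fin⟩
  have hA : ContDiff ℝ ∞ (fun y : EuclideanSpace ℝ (Fin 5) => padL y + c • axis) :=
    padL.contDiff.add contDiff_const
  have hval : ContMDiff (𝓡 4) 𝓘(ℝ, EuclideanSpace ℝ (Fin 5)) ∞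
      (Subtype.val : Metric.sphere (0 : EuclideanSpace ℝ (Fin 5)) 1 → EuclideanSpace ℝ (Fin 5)) :=
    contMDiff_coe_sphere
  have hf : ContMDiff (𝓡 4) (𝓡 6) ∞ (sliceMap c) := hA.comp_contMDiff hval
  refine Literature.Topology.FourManifolds.isSmoothEmbedding_of_injective_of_injective_mfderiv hf
    (by norm_num) ?_ ?_
  · intro x x' h
    apply Subtype.ext
    ext i
    simpa using congrArg (fun z : EuclideanSpace ℝ (Fin 6) => z (Fin.castSucc i)) h
  · intro x
    have h1 : HasMFDerivAt (𝓡 4) 𝓘(ℝ, EuclideanSpace ℝ (Fin 5))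
        (Subtype.val : Metric.sphere (0 : EuclideanSpace ℝ (Fin 5)) 1 → EuclideanSpace ℝ (Fin 5)) x
        (mfderiv (𝓡 4) 𝓘(ℝ, EuclideanSpace ℝ (Fin 5))
          (Subtype.val : Metric.sphere (0 : EuclideanSpace ℝ (Fin 5)) 1 → EuclideanSpace ℝ (Fin 5)) x) :=
      ((hval x).mdifferentiableAt (by simp)).hasMFDerivAt
    have h2 : HasFDerivAt (fun y : EuclideanSpace ℝ (Fin 5) => padL y + c • axis) padL
        (x : EuclideanSpace ℝ (Fin 5)) :=
      padL.hasFDerivAt.add_const _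
    have h3 := h2.hasMFDerivAt.comp x h1
    rw [sliceMap_eq_comp, h3.mfderiv]
    exact padL_injective.comp (mfderiv_coe_sphere_injective x)

/-- **A set containing a whole slice separates the two ends of `N`** in the typed sense of the route
items: no path in `N ∖ A` joins a point of height `≤ -(|c|+1)` to one of height `≥ |c|+1`, because the
height along the path takes the value `c` (intermediate value theorem) at a point of `N`, i.e. of the
slice `⊆ A`. [folklore] -/
theorem separatesEnds_of_slice_subset {A : Set (EuclideanSpace ℝ (Fin 6))} {c : ℝ}
    (h : {z : EuclideanSpace ℝ (Fin 6) | ∑ i : Fin 5, z (Fin.castSucc i) ^ 2 = 1 ∧ z 5 = c} ⊆ A) :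
    ∃ R : ℝ, ∀ a b : EuclideanSpace ℝ (Fin 6), ∑ i : Fin 5, a (Fin.castSucc i) ^ 2 = 1 →
      ∑ i : Fin 5, b (Fin.castSucc i) ^ 2 = 1 → a 5 ≤ -R → R ≤ b 5 →
        ¬ JoinedIn ({z : EuclideanSpace ℝ (Fin 6) | ∑ i : Fin 5, z (Fin.castSucc i) ^ 2 = 1} \ A) a b := by
  refine ⟨|c| + 1, fun a b _ _ hac hcb hj => ?_⟩
  obtain ⟨γ, hγ⟩ := hj
  set g : ℝ → ℝ := fun s => (γ.extend s) 5 with hg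
  have hgc : Continuous g := (EuclideanSpace.proj (5 : Fin 6)).continuous.comp γ.continuous_extend
  have h0 : g 0 = a 5 := by simp [hg]
  have h1 : g 1 = b 5 := by simp [hg]
  have hc : c ∈ Set.Icc (g 0) (g 1) := by
    rw [h0, h1]
    constructor <;> linarith [le_abs_self c, neg_abs_le c]
  obtain ⟨s, hs, hsc⟩ := intermediate_value_Icc zero_le_one hgc.continuousOn hc
  have hmem := hγ ⟨s, hs⟩
  rw [← Path.extend_extends' γ ⟨s, hs⟩] at hmem
  exact hmem.2 (h ⟨hmem.1, hsc⟩)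

/-! ### Two slices -/

/-- Two disjoint slices (heights `0` and `1`), as one map `S⁴ ⊔ S⁴ → ℝ⁶`. [folklore] -/
def twoSlices : (Metric.sphere (0 : EuclideanSpace ℝ (Fin 5)) 1) ⊕ (Metric.sphere (0 : EuclideanSpace ℝ (Fin 5)) 1) →
    EuclideanSpace ℝ (Fin 6) :=
  Sum.elim (sliceMap 0) (sliceMap 1)

/-- Two disjoint slices form a smooth embedding of `S⁴ ⊔ S⁴` (tree: `Manifold.IsSmoothEmbedding.sumElim`;
the images have different heights). [folklore] -/
theorem isSmoothEmbedding_twoSlices : Manifold.IsSmoothEmbedding (𝓡 4) (𝓡 6) ∞ twoSlices := by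
  refine (isSmoothEmbedding_sliceMap 0).sumElim (isSmoothEmbedding_sliceMap 1) ?_
  rw [Set.disjoint_iff]
  rintro z ⟨⟨x, rfl⟩, ⟨y, hy⟩⟩
  have h := congrArg (fun z : EuclideanSpace ℝ (Fin 6) => z 5) hy
  simp only [sliceMap_apply_last] at h
  exact one_ne_zero h

/-- Every point of the two-slice configuration lies in `N`. [folklore] -/
theorem sum_sq_twoSlices (x : (Metric.sphere (0 : EuclideanSpace ℝ (Fin 5)) 1) ⊕
    (Metric.sphere (0 : EuclideanSpace ℝ (Fin 5)) 1)) :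
    ∑ i : Fin 5, twoSlices x (Fin.castSucc i) ^ 2 = 1 := by
  rcases x with x | x <;> exact sum_sq_sliceMap _ x

/-- The image of the two-slice configuration is the union of the slices at heights `0` and `1`. [folklore] -/
theorem range_twoSlices : Set.range twoSlices =
    {z : EuclideanSpace ℝ (Fin 6) | ∑ i : Fin 5, z (Fin.castSucc i) ^ 2 = 1 ∧ z 5 = 0} ∪
    {z : EuclideanSpace ℝ (Fin 6) | ∑ i : Fin 5, z (Fin.castSucc i) ^ 2 = 1 ∧ z 5 = 1} := by
  rw [twoSlices, Set.Sum.elim_range, range_sliceMap, range_sliceMap]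

/-- The unit `4`-sphere is preconnected (`dim ℝ⁵ = 5 > 1`, Mathlib `isPreconnected_sphere`). [folklore] -/
theorem preconnectedSpace_sphere_four : PreconnectedSpace (Metric.sphere (0 : EuclideanSpace ℝ (Fin 5)) 1) := by
  refine Subtype.preconnectedSpace (isPreconnected_sphere ?_ 0 1)
  rw [← Module.finrank_eq_rank, finrank_euclideanSpace_fin]
  norm_num

/-- **`S⁴ ⊔ S⁴` is not diffeomorphic (not even homeomorphic) to `S⁴`**: the range of `Sum.inl` is a
proper non-empty clopen subset, and `S⁴` is preconnected. [folklore] -/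
theorem isEmpty_diffeomorph_twoSpheres :
    IsEmpty (((Metric.sphere (0 : EuclideanSpace ℝ (Fin 5)) 1) ⊕ (Metric.sphere (0 : EuclideanSpace ℝ (Fin 5)) 1))
      ≃ₘ⟮𝓡 4, 𝓡 4⟯ Metric.sphere (0 : EuclideanSpace ℝ (Fin 5)) 1) := by
  haveI := preconnectedSpace_sphere_four
  refine ⟨fun e => ?_⟩
  let p : Metric.sphere (0 : EuclideanSpace ℝ (Fin 5)) 1 := ⟨EuclideanSpace.single 0 1, by simp⟩
  set f := e.toHomeomorph
  have hclopen : IsClopen (f.symm ⁻¹' Set.range Sum.inl) :=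
    f.symm.isQuotientMap.isClopen_preimage.2 isClopen_range_inl
  rcases isClopen_iff.1 hclopen with h | h
  · have hp : f (Sum.inl p) ∈ f.symm ⁻¹' Set.range Sum.inl := by
      rw [Set.mem_preimage, Homeomorph.symm_apply_apply]
      exact ⟨p, rfl⟩
    rw [h] at hp
    exact hp
  · have hp : f (Sum.inr p) ∈ f.symm ⁻¹' Set.range Sum.inl := by
      rw [h]
      trivial
    rw [Set.mem_preimage, Homeomorph.symm_apply_apply] at hp
    obtain ⟨q, hq⟩ := hp
    exact Sum.inl_ne_inr hq

end Literature.Geometry.Manifold.CylinderSlice
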